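import Summits.Ventures.PercRepro.RankLevelSetLevelSixHeavyCellSq27DI3U
import Summits.Ventures.PercRepro.RankLevelSetCoreSixColoopFreeFlatCap
import Summits.Ventures.PercRepro.RankLevelSetLevelSixCapGlue25
import Summits.Ventures.PercRepro.TriangleCapEightI
import Summits.Ventures.PercRepro.S1TrianglePlusSharp
import Summits.Ventures.PercRepro.S1SeriesLever14
import Summits.Ventures.PercRepro.RankLevelSetLevelSixArithHeavySq24DF7A

/-!
# PercRepro — THE 24 ROW, THE COLOOP-FREE CELL `(p ≥ 24, 7)` WITH THE COLOOP-FREE FLAT CAP (p8 g10, S3)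

`proofs/SUBCLAIM-S3-p8.md` §3x. On a coloop-free core the rank-`6` sets have `≤ 5 + d = 12` points and the rank-`5` sets `≤ 11` (RankLevelSetCoreSixColoopFreeFlatCap), so at `ν₁ = 7 = d` the heavy classes are EMPTY (`UG_eq_empty_of_cap`, `UH_eq_empty`): the cell `sq27di3u` with `uG = uH = 0`, the coloop-free caps `s₃ ≤ 11`, `s₄ ≤ 47`, `s₅ ≤ 250` at `n₀ = 31` and the parts ArithHeavySq24DF7A (`Kn = 175834`): ratio `0.991` (checks/cf_small24.out). Axioms: standard.
-/

open scoped Matroid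

namespace PercRepro

namespace ThmN

open Set

variable {α : Type}

/-- **The COLOOP-FREE `e`-free core at level `6`, corank `7`, rank `p ≥ 24`** — the heavy classes empty by the coloop-free flat cap. -/
theorem c025_core_six_basis_sq24_free7 (M : Matroid α) [M.Finite] (p : ℕ) (hp : 24 ≤ p) (hcf : ∀ e ∈ M.E, ¬ M.IsColoop e)
    (hR : M.eRank = (p : ℕ∞)) (hn : M.E.ncard = p + 7)
    (hfree : ∀ e ∈ M.E, ∃ A ⊆ M.E \ {e}, e ∉ M.closure A ∧ e ∉ M.closure ((M.E \ {e}) \ A)) :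
    RLS M p 6 := by
  classical
  have hEcard : M.ground_finite.toFinset.card = p + 7 := by
    rw [← Set.ncard_eq_toFinset_card _ M.ground_finite]; exact hn
  have hd : M.E.encard = M.eRank + (7 : ℕ) := by
    rw [hR, ← M.ground_finite.cast_ncard_eq, hn]
    push_cast
    ring
  have hsp : ({X : Set α | X ⊆ M.E ∧ M.eRk X = M.eRank}.ncard : ℚ) ≤
      ∑ j ∈ Finset.range (7 + 1), (((p + 7).choose j : ℕ) : ℚ) := by
    have := Matroid.ncard_spanning_le (M := M) hd
    rw [hEcard] at this
    exact_mod_cast this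
  have hflat6 : ∀ X ⊆ M.E, M.eRk X ≤ ((6 : ℕ) : ℕ∞) → X.ncard ≤ 12 :=
    fun X hX hr => ncard_le_five_add_of_coloopFree M hcf hR hn (by omega) hX (by exact_mod_cast hr)
  have hflat5 : ∀ X ⊆ M.E, M.eRk X ≤ ((6 - 1 : ℕ) : ℕ∞) → X.ncard ≤ 11 :=
    fun X hX hr => ncard_le_four_add_of_coloopFree M hcf hR hn (by omega) hX hr
  have hUG : (Matroid.UG M 6 7).ncard ≤ 0 := by
    rw [UG_eq_empty_of_cap M hflat6 (by norm_num)]; simp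
  have hUH : (Matroid.UH M 6 7).ncard ≤ 0 := by
    rw [Matroid.UH_eq_empty (M := M) (q := 6) (ν₁ := 7) hflat5 (by norm_num)]; simp
  have hΦ : phiK p 6 ≤ (2 : ℚ) ^ (p + 6) / (((p + 6).choose 6 : ℕ) : ℚ) := phiK_le_two_pow_div_six p
  rw [RLS_iff]
  exact c025_core_six_heavy_cell_sq27di3u M p 7 7 0 0 0 175834 1000 13 250 47 11
      ((p + 6).choose 6) (Nat.choose_pos (by omega)) (phiK p 6) hΦ (by norm_num) (by omega)
      (∑ j ∈ Finset.range (7 + 1), (((p + 7).choose j : ℕ) : ℚ)) hsp (by norm_num) hUG hUH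
      (Or.inl (by norm_num)) (by norm_num) (by norm_num) (by norm_num)
      (s3_cf_of M hfree hcf (d := 6) (by simpa using hd) 31 11 (by norm_num) (by omega) (by norm_num [TriangleCap.cq3]) (by norm_num [TriangleCap.cq3]) (by norm_num [TriangleCap.cq3]))
      (s4_cf_of M hfree hcf (d := 6) (by rw [hd]; norm_num) 31 41 47 (by norm_num) (by omega) (by decide) (by omega))
      (s5_cf_of M hfree hcf (d := 6) (by rw [hd]; norm_num) 31 210 250 (by norm_num) (by omega) (by decide) (by omega))
      (tail_six_heavy_sq24DF7_7 p hp) hR hn hfree (level_six_poly_heavy_sq24DF7_7 p hp)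

end ThmN

end PercRepro
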